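import Mathlib.Topology.Algebra.InfiniteSum.Real
import Mathlib.Analysis.SpecificLimits.Basic
import Mathlib.Data.Finset.Card
import Mathlib.Order.Monotone.Basic
import Mathlib.Tactic.Linarith
import Mathlib.Tactic.Positivity
import Mathlib.Tactic.Ring
import HarnessLib

/-!
# Barrier: one-dimensional long-range lattice gases with non-periodic (Sturmian) ground states —
# Hubbard's generalized Wigner lattices / most homogeneous configurations

Topic: `Literature/Barriers/AtomisticToContinuum` (barrier catalogue of
`AtomisticToContinuum/Crystallization`, D-0021; seat 2). Relevant to the stacking-selection
cruxes of the routes `CrystalLocalRigidity` (c) / `CrystalKissingRigidity` (K3) /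
`RefuteCrystalPeriodicMin`, which reduce the competition between Lennard-Jones Barlow stackings
to a ONE-dimensional lattice model with infinite-range couplings `J_k` on Hägg sequences and ask
whether its minimisers are periodic.

## The result, as printed (Jędrzejewski–Miękisz, J. Stat. Phys. 98 (2000), arXiv:cond-mat/9903163)

§2: lattice gas on `ℤ`, occupations `s_i(X) ∈ {0, 1}`, two-body translation-invariant energy
`V(|i - j|) s_i s_j`, `H_Λ(X) = ∑_{{i,j} ∩ Λ ≠ ∅} V(|i-j|) s_i(X) s_j(X)`; local excitation
`Y ∼ X` (equal off a bounded `Λ`), relative Hamiltonian `H(Y, X)` = the same sum of differences;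
"`X` is a ground-state configuration of `H` if `H(Y,X) ≥ 0` for any `Y ∼ X`"; `V` "summable and
for `r ≥ r₀` positive and strictly convex (see the Appendix), hence decreasing", normalised to
`0` at infinity, denoted `V_{r₀}`; Appendix Definition 1: convex iff `f(n+1) + f(n-1) ≥ 2f(n)`
for `n ≥ n₀ + 1`. "For every particle density `ρ`, there is a unique sequence of natural numbers
`d_n`, such that the separations between any pair of `n`-th nearest-neighbor particles are `d_n`
or `d_n + 1`. Such configurations have been called the generalized Wigner lattices [Hubbard 1978]
or the most homogeneous configurations … If the particle density is rational, then the
corresponding most homogeneous configurations are periodic … while for irrational densities they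
are nonperiodic." **Theorem 0** (Most homogeneous ground-state configurations): "In the
canonical ensemble, i.e., for a given particle density `ρ`, the ground-state configurations of a
lattice gas (H) with an interaction energy `V₁` are the most homogeneous configurations. This
statement has been proven (or at least a proof has been outlined) by Hubbard and Pokrovsky and
Uimin … a proof for the related Frenkel-Kontorova model has been provided by Aubry and adapted to
the lattice-gas model case by Miękisz and Radin". Grand-canonically: "to have a ground state
with an irrational density `ρ` of particles, one has to fix `μ(ρ) = de(ρ)/dρ`"; the plateaux of
rational densities fill the whole interval of chemical potentials — "the complete devil's
staircase"; "For certain values of external parameters, like the chemical potential or the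
particle density … our models do not have periodic ground-state configurations" (§2, pp. 5–6).
Abstract: "there is only one example of a lattice system with long-range two-body interactions
whose ground states have been determined exactly". Miękisz 1998, §3: the same model, "For any
irrational `ρ`, there are uncountably many ground-state configurations which are the most
homogeneous configurations."

## Lean rendering (namespace `Literature.Barriers.AtomisticToContinuum.HubbardChain`)

* `IsHubbardPotential V` — `V : ℕ → ℝ` summable, `V n > 0` and strictly convex for `n ≥ 1`
  (`V(n+1) + V(n-1) > 2 V(n)` for `n ≥ 2`), the class `V₁` with strict convexity.
* configurations `X : ℤ → Bool`; `relHamiltonian V Λ Y X` — the relative Hamiltonian as a `tsum`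
  over the pairs `i < j` meeting the finite set `Λ` (absolutely convergent for summable `V`);
* `IsCanonicalGroundStateConfig V X` — `H(Y, X) ≥ 0` for every local excitation `Y ∼ X` off a
  finite `Λ` WITH THE SAME NUMBER OF PARTICLES in `Λ` (our reading of "in the canonical ensemble,
  i.e., for a given particle density": particle-conserving local changes);
* `IsMostHomogeneous x` for a bi-infinite increasing enumeration `x : ℤ → ℤ` of the particles:
  for every `n ≥ 1` some `d_n` with `x(i+n) - x(i) ∈ {d_n, d_n + 1}` for all `i` (Miękisz's form);
* `Hubbard1978_mostHomogeneous : Prop` — NAMED FACT, the direction of Theorem 0 used as a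
  barrier: most homogeneous configurations are canonical ground-state configurations.
  DISCHARGED: theorem `Hubbard1978_mostHomogeneous_holds` in
  `MostHomogeneousGroundStatesProofs.lean` (Hubbard's supporting-line convexity argument).
  NARROWED (barrier audit 2026-08-15): `MostHomogeneousGroundStatesNarrow.lean`, entry
  `Hubbard1978_mostHomogeneousNarrow` (proved) — the periodic ansatz is defeated only at a
  prescribed irrational density or at the exceptional (Lebesgue-null) chemical potentials of the
  complete devil's staircase; see `scope_caveats` / `evasions_known` below.

## Sources

* J. Jędrzejewski, J. Miękisz, *Ground states of lattice gases with "almost" convex repulsive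
  interactions*, J. Stat. Phys. 98 (2000) 589–620, arXiv:cond-mat/9903163: abstract, §1 (p. 3),
  §2 (pp. 5–6, Theorem 0), Appendix Definition 1 and Lemma A1 (p. 18).
* J. Miękisz, *An ultimate frustration in classical lattice-gas models*, J. Stat. Phys. 90 (1998),
  arXiv:cond-mat/9706293, §3 (p. 5).
* C. Radin, *Global order from local sources*, Bull. AMS 24 (1991), §3a (p. 9).
* S. Aubry, *Complete devil's staircase in the one-dimensional lattice gas*, J. Physique Lett. 44
  (1983) L-247–L-250 (HAL jpa-00232188): eqs. (1)–(3), (5)–(7), pp. L-249/250 (audit 2026-08-15).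
* F. J. Burnell, M. M. Parish, N. R. Cooper, S. L. Sondhi, Phys. Rev. B 80 (2009) 174519,
  arXiv:0901.4366: abstract and eq. (2) (audit 2026-08-15).
* J. Hubbard, Phys. Rev. B 17 (1978) 494; V. L. Pokrovsky, G. V. Uimin, J. Phys. C 11 (1978)
  3535; P. Bak, R. Bruinsma, Phys. Rev. Lett. 49 (1982) 249; S. Aubry, J. Phys. C 16 (1983) 2497
  (all cited through the two sources above; not held).

## Wording risks

* Only the direction "most homogeneous ⇒ ground state" is vendored; the converse in Theorem 0 is
  asserted by the source for strictly ergodic ground states without interfaces (§2, p. 5) and is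
  not transcribed. The source itself hedges the original proofs ("or at least a proof has been
  outlined"), pointing to Aubry / Miękisz–Radin for a proof; see `status`.
* `IsMostHomogeneous` presupposes infinitely many particles in both directions (density `> 0`);
  the vacuum (`ρ = 0`) is trivially a ground state and is not covered by the enumeration form.
-/

noncomputable section

open scoped BigOperators

namespace Literature.Barriers.AtomisticToContinuum.HubbardChain

/-- **Hubbard's interaction class `V₁`** (with strict convexity): `V : ℕ → ℝ` (the energy of two
particles at distance `n ≥ 1`; `V 0` is never used) is summable, positive for `n ≥ 1`, and
strictly convex from distance `1` on, `V(n+1) + V(n-1) > 2V(n)` for `n ≥ 2` — hence decreasing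
to `0`. [cite: JedrzejewskiMiekisz2000, §2 (p. 6) and Appendix Definition 1] -/
def IsHubbardPotential (V : ℕ → ℝ) : Prop :=
  Summable V ∧ (∀ n, 1 ≤ n → 0 < V n) ∧ ∀ n, 2 ≤ n → 2 * V n < V (n + 1) + V (n - 1)

/-- The pair energy `V(|i - j|) s_i s_j` of the sites `i, j` in the configuration `X`.
[cite: JedrzejewskiMiekisz2000, §2 (1)] -/
def pairEnergy (V : ℕ → ℝ) (X : ℤ → Bool) (i j : ℤ) : ℝ :=
  if X i ∧ X j then V (j - i).natAbs else 0

/-- **The relative Hamiltonian** `H(Y, X) = ∑_{{i,j} ∩ Λ ≠ ∅} (V(|i-j|) s_i(Y)s_j(Y) - V(|i-j|) s_i(X)s_j(X))`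
of a local excitation `Y` of `X` off the finite set `Λ`, as an (absolutely convergent, for
summable `V`) sum over the ordered pairs `i < j` meeting `Λ`.
[cite: JedrzejewskiMiekisz2000, §2 (2)] -/
def relHamiltonian (V : ℕ → ℝ) (Λ : Finset ℤ) (Y X : ℤ → Bool) : ℝ :=
  ∑' p : {p : ℤ × ℤ // p.1 < p.2 ∧ (p.1 ∈ Λ ∨ p.2 ∈ Λ)},
    (pairEnergy V Y p.1.1 p.1.2 - pairEnergy V X p.1.1 p.1.2)

/-- **Canonical ground-state configuration**: "`X` is a ground-state configuration of `H` if
`H(Y,X) ≥ 0` for any `Y ∼ X`", here — "in the canonical ensemble, i.e., for a given particle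
density" — for the local excitations `Y` that agree with `X` off a finite `Λ` and have the same
number of particles in `Λ`. [cite: JedrzejewskiMiekisz2000, §2 (p. 5) and Theorem 0 (p. 6)] -/
def IsCanonicalGroundStateConfig (V : ℕ → ℝ) (X : ℤ → Bool) : Prop :=
  ∀ (Λ : Finset ℤ) (Y : ℤ → Bool), (∀ i ∉ Λ, Y i = X i) →
    (Λ.filter fun i => Y i).card = (Λ.filter fun i => X i).card → 0 ≤ relHamiltonian V Λ Y X

/-- The configuration occupied exactly at the sites `x(i)`, `i ∈ ℤ`. [folklore] -/
def configOf (x : ℤ → ℤ) : ℤ → Bool := fun j => @decide (j ∈ Set.range x) (Classical.dec _)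

/-- **Most homogeneous configuration** (generalized Wigner lattice), in the form of a bi-infinite
increasing enumeration `x` of the particles: for every `n ≥ 1` there is `d_n` such that the
separation `x(i+n) - x(i)` of every pair of `n`-th nearest-neighbour particles is `d_n` or
`d_n + 1`. [cite: JedrzejewskiMiekisz2000, §2 (p. 6)] [cite: Miekisz1998, §3 (p. 5)] -/
def IsMostHomogeneous (x : ℤ → ℤ) : Prop :=
  StrictMono x ∧ ∀ n : ℕ, 1 ≤ n → ∃ d : ℤ, ∀ i : ℤ, x (i + n) - x i = d ∨ x (i + n) - x i = d + 1

/-- NAMED FACT — **Hubbard 1978 / Pokrovsky–Uimin 1978 (Theorem 0 of Jędrzejewski–Miękisz, the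
direction used here): for an interaction of class `V₁`, every most homogeneous configuration is a
ground-state configuration in the canonical ensemble.** The technique class stopped:
periodic-ansatz / period-scanning and finite-coupling truncation for ONE-dimensional lattice
models with INFINITE-range two-body couplings — deciding "is the infimum over periodic
configurations attained, and by which period" by comparing periodic candidates, as in the
stacking-selection reduction of the Lennard-Jones fcc/hcp/Barlow competition to a long-range
model on Hägg sequences (routes `RefuteCrystalPeriodicMin`, `CrystalLocalRigidity` (c)).

* technique_class: periodic-ansatz-1d period-scanning finite-coupling-truncation periodic-minimiser-assumption one-dimensional-long-range-lattice-gas stacking-sequence-effective-model hagg-sequence-reduction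
* blocks: the expectation, valid for FINITE range ("every 1 dimensional problem has a periodic ground state") [cite: Radin1991, §3a (p. 9)], that one-dimensional effective models have periodic minimisers: in Hubbard's class the ground-state configurations at density `ρ` are the most homogeneous ones, "periodic" for rational `ρ` "while for irrational densities they are nonperiodic" [cite: JedrzejewskiMiekisz2000, §2 (p. 6) and Theorem 0]; grand-canonically the irrational densities are realised at `μ(ρ) = de(ρ)/dρ` and "for certain values of external parameters, like the chemical potential or the particle density … our models do not have periodic ground-state configurations" — the complete devil's staircase [cite: JedrzejewskiMiekisz2000, §2 (pp. 5–6)]; "For any irrational `ρ`, there are uncountably many ground-state configurations which are the most homogeneous configurations" [cite: Miekisz1998, §3 (p. 5)]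
* because: for positive, decreasing, strictly convex `V` particles are "distributed as far as possible from each other, respecting restrictions imposed on their locations by the underlying lattice" (generalized Wigner lattices), independently "of any further details of the interaction potential" [cite: JedrzejewskiMiekisz2000, §1 (p. 3)]; the convexity inequality `f(x) + f(y) ≥ f(s) + f(t)` for `x ≤ s < t ≤ y`, `x + y ≤ s + t` [cite: JedrzejewskiMiekisz2000, Appendix Lemma A1]; `e(ρ)` is differentiable at irrational and not at rational `ρ` (Aubry) [cite: JedrzejewskiMiekisz2000, §2 (p. 6)]
* evasions_known: (i) finite-range one-dimensional interactions: periodic ground states always exist, even algorithmically [cite: Radin1991, §3a (p. 9)] [cite: JedrzejewskiMiekisz2000, §1 (p. 3: "an algorithmic method")]; (ii) rational density / chemical potential inside a plateau: "a unique (up to translations) periodic ground-state configuration" [cite: Miekisz1998, §3 (p. 5)]; (iii) leaving the convex class changes the answer — with `V(1)` lowered, `2`-molecule most homogeneous configurations appear, still a complete devil's staircase [cite: JedrzejewskiMiekisz2000, abstract and Theorem 1]; (iv) no density constraint and no chemical potential (unconstrained minimisation over all configurations, the analogue of minimising a stacking energy over all sequences): "if we do not fix the density … the vacuum is the only ground state"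 [cite: Miekisz1998, §3 (p. 5)] (`isGroundStateConfig_vacuum` in the Narrow file); (v) Lebesgue-almost every chemical potential: the rational plateaux `[d⁻e/dρ, d⁺e/dρ]` have lengths summing to the whole staircase interval [cite: JedrzejewskiMiekisz2000, §2 (p. 6)], Burkov's exceptional set "has measure zero which means … that the devil's staircase is complete" [cite: Aubry1983LatticeGas, pp. L-249–L-250], "every commensurate state at a rational filling is stable over a finite interval in chemical potential … the total measure of all such intervals exhausts the full range of `μ`" [cite: BurnellParishCooperSondhi2009, abstract and eq. (2)] — off a closed null (nowhere dense) set of `μ` the ground state is the unique `q`-periodic most homogeneous configuration, found by scanning the single period `q`; (vi) the VALUE is never missed: `e(ρ)` is convex [cite: JedrzejewskiMiekisz2000, §2 (p. 6)] and given by piecewise-linear shell energies [cite: Aubry1983LatticeGas, eqs. (5)–(7)], so the infimum of `e - μρ` over periodic configurations equals the ground-state energy density at every `μ` — only attainment fails, and only on the null set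
* scope_caveats: the class is REPULSIVE, positive, strictly convex `V`; nothing is asserted for sign-changing or non-convex couplings such as the Lennard-Jones interlayer couplings `J_k` of the stacking routes (whose signs and convexity are not established), nor for continuum systems; only the direction "most homogeneous ⇒ ground state" is vendored (the converse is printed for strictly ergodic ground states without interfaces [cite: JedrzejewskiMiekisz2000, §2 (p. 5)]); "canonical" is transcribed as particle-conserving local excitations; NARROWED 2026-08-15 (`Hubbard1978_mostHomogeneousNarrow`, proved): of the technique class above only `periodic-minimiser-assumption` / `periodic-ansatz-1d` AT A PRESCRIBED IRRATIONAL DENSITY (where no periodic configuration is admissible at all — a translation symmetry of a bi-infinite increasing enumeration is an index shift with rational mean gap, `mean_gap_of_periodic`) or AT AN EXCEPTIONAL `μ` (evasion (v)) is actually defeated by the printed result; `period-scanning` and `finite-coupling-truncation` as computations of the minimum VALUE are not (evasion (vi); truncating a summable `V` at range `R` moves every energy density by at most the tail `∑_{n>R} V(n)`, uniformly in the configuration), and the routes' Hägg-sequence stacking functional `∑_k J_k 1[s_m+⋯+s_{m+k-1} ≡ 0 (3)]` (`Literature.MathematicalPhysics.StatisticalMechanics.haggEnergy`: many-body in the spins,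 no conserved density, no chemical potential, couplings of unrestricted sign) lies outside Hubbard's two-body class, so `stacking-sequence-effective-model` / `hagg-sequence-reduction` are covered only by analogy — an analogy whose own lesson is locking into a periodic phase off a null parameter set
* status: DISCHARGED — theorem `Hubbard1978_mostHomogeneous_holds` (`MostHomogeneousGroundStatesProofs.lean`, axioms `propext`/`Classical.choice`/`Quot.sound`); printed provenance: established (Hubbard 1978; Pokrovsky–Uimin 1978 — "proven (or at least a proof has been outlined)"; proof via Aubry 1983 adapted by Miękisz–Radin, as reported in [cite: JedrzejewskiMiekisz2000, §2 (p. 6)]; described as the one exactly solved long-range lattice example [cite: JedrzejewskiMiekisz2000, abstract]; no dissent found)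

[cite: JedrzejewskiMiekisz2000, §2 Theorem 0 (p. 6)] -/
def Hubbard1978_mostHomogeneous : Prop :=
  ∀ V : ℕ → ℝ, IsHubbardPotential V →
    ∀ x : ℤ → ℤ, IsMostHomogeneous x → IsCanonicalGroundStateConfig V (configOf x)

/-! ### API and non-vacuity -/

/-- `V(n) = 2^{-n}` is a Hubbard potential: summable, positive, strictly convex
(`2·2^{-n} = 2^{-(n-1)} < 2^{-(n+1)} + 2^{-(n-1)}`). [folklore] -/
theorem isHubbardPotential_geometric : IsHubbardPotential fun n => ((1 : ℝ) / 2) ^ n := by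
  refine ⟨summable_geometric_of_lt_one (by norm_num) (by norm_num), fun n _ => by positivity, ?_⟩
  intro n hn
  obtain ⟨m, rfl⟩ : ∃ m, n = m + 2 := ⟨n - 2, by omega⟩
  rw [show m + 2 - 1 = m + 1 from rfl, show m + 2 + 1 = m + 3 from rfl]
  dsimp only
  have h1 : (0 : ℝ) < (1 / 2) ^ (m + 3) := by positivity
  have e1 : (2 : ℝ) * (1 / 2) ^ (m + 2) = (1 / 2) ^ (m + 1) := by rw [pow_succ]; ring
  rw [e1]
  linarith

/-- The equally spaced configuration `x(i) = a i + b` (`a ≥ 1`) is most homogeneous with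
`d_n = a n`: the periodic, rational-density (`ρ = 1/a`) case. [cite: Miekisz1998, §3 (p. 5)] -/
theorem isMostHomogeneous_arithmetic {a : ℤ} (ha : 0 < a) (b : ℤ) :
    IsMostHomogeneous fun i => a * i + b := by
  refine ⟨fun i j hij => ?_, fun n _ => ⟨a * n, fun i => ?_⟩⟩
  · dsimp only
    have := mul_lt_mul_of_pos_left hij ha
    linarith
  · left; ring

/-- Under the fact, the equally spaced configurations are canonical ground states for every
Hubbard potential. [cite: JedrzejewskiMiekisz2000, §2 Theorem 0] -/
theorem Hubbard1978_mostHomogeneous.arithmetic (h : Hubbard1978_mostHomogeneous) {V : ℕ → ℝ}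
    (hV : IsHubbardPotential V) {a : ℤ} (ha : 0 < a) (b : ℤ) :
    IsCanonicalGroundStateConfig V (configOf fun i => a * i + b) :=
  h V hV _ (isMostHomogeneous_arithmetic ha b)

/-- A `p`-periodic enumeration up to the translation `q` (`x(i + p) - x(i) = q` for all `i`)
satisfies `x(kp) - x(0) = kq`: its mean gap is the rational `q/p` (density `p/q`) — the
elementary reason why most homogeneous configurations of IRRATIONAL density, which exist for every
density, cannot be periodic. [cite: JedrzejewskiMiekisz2000, §2 (p. 6)] -/
theorem mean_gap_of_periodic {x : ℤ → ℤ} {p : ℕ} {q : ℤ}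
    (hper : ∀ i, x (i + p) - x i = q) (k : ℕ) : x (k * p) - x 0 = k * q := by
  induction k with
  | zero => simp
  | succ m ih =>
    have := hper (m * p)
    push_cast at this ih ⊢
    have e : ((m : ℤ) + 1) * p = m * p + p := by ring
    rw [e]
    linarith

end Literature.Barriers.AtomisticToContinuum.HubbardChain

end
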